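import Summits.ResolutionOfSingularities.ResolutionOfSingularities.Theorems.FrobeniusClosingPatchingRelPerfectDepthPhaseCReachNDomDefs
import Summits.ResolutionOfSingularities.ResolutionOfSingularities.Theorems.FrobeniusClosingPatchingRelPerfectDepthPhaseCReachBasic
import Summits.ResolutionOfSingularities.ResolutionOfSingularities.Theorems.FrobeniusClosingPatchingRelPerfectDepthPhaseCStepStalk
import Summits.ResolutionOfSingularities.ResolutionOfSingularities.Theorems.FrobeniusClosingPatchingRelPerfectDepthEquimultipleTransformOrder
import Summits.ResolutionOfSingularities.ResolutionOfSingularities.Theorems.FrobeniusClosingPatchingRelPerfectDepthCylinderCentreBookkeeping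
import Summits.ResolutionOfSingularities.ResolutionOfSingularities.Theorems.FrobeniusClosingPatchingRelPerfectDepthPhaseCCarrierCountdown
import Literature.AlgebraicGeometry.Resolution.AlterationsLemma411Blowup
import Literature.AlgebraicGeometry.Resolution.BlowupOffCentre
import HarnessLib

/-!
# Crux `PatchingRelPerfect` (stmt-ResolutionOfSingularities-16161), chain W5.2 — F7(β) (β-AX) X3 C-I (M0) part 2:
# THE BOOKKEEPING CLAUSE «N-DOMINATION» IS INITIALLY VALID AND SURVIVES THE CYLINDER STEP

[OURS · L1 W5.2 · res-L1-w52-plan-1 RULING G12-23 (1) (hand res-L1-w52-lead-1 g6); design res-L1-w52-idea-1 WORD P (n3) 19:39:05Z;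
virtual/positional form res-L1-w52-lead-1 19:58Z.]  Replaces the role of NO printed item; NOT a statement of the manuscript under review
(AI-written; AI review weaker than expert review; counted 0).  No definitions (the clause `ChainW52F7BetaRP.NDominates` is
`…DepthPhaseCReachNDomDefs`).

* §0 list bookkeeping for `weightAt` (domination position by position, prefix/suffix split).
* §1 `atlasInitial_isRegular` / `stepStable_isRegular` / `CylReach.isRegular` — the ambient scheme of a reachable cylinder state is regular
  (generation 1: `DepthInvariant.isRegular`; step: `IsBlowup.isRegular_of_isRegular_subscheme`, the centre being regular by
  `HasSNCWith.isRegular_subscheme`).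
* §2 `atlasInitial_nDominates` — generation 1: every member is the carrier (`n₀ := S.𝓔.length`, domination vacuous), `𝓝 := (Z, 2), (Z, 0), …`,
  and `monomialIdeal 𝓝 = 𝓘_Z² ≤ K` from `InitialShape` (`DepthInvariant.ker_pow_le`, `i.ker = cyl.j.ker` as both are the ideal of the same
  reduced closed subscheme).
* §3 `nDominates_step` — THE STEP in open form over the v7 `StepStable` binders it uses, PLUS the X-side equimultiplicity
  `hequiX : ∀ i, ∀ y ∈ cyl.centre C, idealOrder (S.host i) y = m i` (res-L1-w52-stub-1 (EQ-glue) layer C, NAMING G12-22; consumed by name when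
  it lands): `𝓝′ := 𝓝.map (st × id) ++ [(F, weightAt 𝓝 η)]`, `monomialIdeal 𝓝′ = τ^*(monomialIdeal 𝓝) ≤ K′`
  (`DepthCylinderCentre.comap_host_mul_monomialIdeal_of_isGenericPoint`), prefix by `hker`; at a point `x′` where a host has order `≥ 2`:
  off the exceptional member `τ` is a stalk isomorphism, over the centre `m i ≥ 2` by `MultiHostState.idealOrder_step_host_le_of_mem` (n2,
  res-D-pv-021) — so the old positions are dominated at `τ x′` and the new one by `weightAt 𝓝 η ≤ 2 + weightAt (exps i) η ≤ e′_i(F)`.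

## References
* J. Kollár, *Lectures on Resolution of Singularities* (2007), (3.111) Steps 1–3. [Kollar2007]
* E. Bierstone, D. Grigoriev, P. Milman, J. Włodarczyk, arXiv:1206.3090, Def. 3.1.3, §4 Step 2b. [BierstoneGrigorievMilmanWlodarczyk2011]
* V. Cossart, O. Piltant, J. Algebra 320 (2008), proof of Prop. 4.2 (a). [CossartPiltant2008]
-/

-- `Summit.<Summit>.<Sub>.Theorems` with `Sub = Summit` (single-conjunct summit, D-0017)
set_option linter.dupNamespace false

noncomputable section

open CategoryTheory AlgebraicGeometry TopologicalSpace IsLocalRing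
open Literature.AlgebraicGeometry.Resolution Scheme.IdealSheafData

namespace Summit.ResolutionOfSingularities.ResolutionOfSingularities.Theorems.ChainW52F7BetaRP

universe u

open DepthMultiHost

/-! ## §0 List bookkeeping for `weightAt` -/

section Lists

variable {X : Scheme.{u}}

/-- The weight at a point is at most the total exponent. [folklore] -/
theorem weightAt_le_sum_map_snd (L : List (X.IdealSheafData × ℕ)) (x : X) : weightAt L x ≤ (L.map Prod.snd).sum := by
  induction L with
  | nil => simp
  | cons p L ih =>
    rw [weightAt_cons, List.map_cons, List.sum_cons]
    refine Nat.add_le_add ?_ ih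
    split_ifs <;> omega

/-- **Position-wise domination on the members through `x` bounds the weight at `x`** (two exponent lists on the same members).
[folklore] -/
theorem weightAt_le_weightAt_of_forall :
    ∀ (L₁ L₂ : List (X.IdealSheafData × ℕ)) (x : X), L₁.map Prod.fst = L₂.map Prod.fst →
      (∀ k, ∀ T : X.IdealSheafData, (L₁.map Prod.fst)[k]? = some T → x ∈ (T.support : Set X) →
        (L₁.map Prod.snd).getD k 0 ≤ (L₂.map Prod.snd).getD k 0) →
      weightAt L₁ x ≤ weightAt L₂ x
  | [], [], _, _, _ => le_rfl
  | [], _ :: _, _, h, _ => by simp at h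
  | _ :: _, [], _, h, _ => by simp at h
  | p :: L₁, q :: L₂, x, hfst, h => by
    rw [List.map_cons, List.map_cons, List.cons.injEq] at hfst
    rw [weightAt_cons, weightAt_cons]
    refine Nat.add_le_add ?_ (weightAt_le_weightAt_of_forall L₁ L₂ x hfst.2 fun k T hk hx => ?_)
    · by_cases hx : x ∈ p.1.support
      · rw [if_pos hx, if_pos (hfst.1 ▸ hx)]
        have := h 0 p.1 (by simp) hx
        simpa using this
      · rw [if_neg hx, if_neg (hfst.1 ▸ hx)]
    · have := h (k + 1) T (by simpa using hk) hx
      simpa using this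

/-- The weight splits along a prefix/suffix decomposition. [folklore] -/
theorem weightAt_eq_take_add_drop (L : List (X.IdealSheafData × ℕ)) (n : ℕ) (x : X) :
    weightAt L x = weightAt (L.take n) x + weightAt (L.drop n) x := by
  conv_lhs => rw [← List.take_append_drop n L]
  exact weightAt_append _ _ x

/-- **THE WEIGHT BOUND OF N-DOMINATION**: if the exponents of `𝓝` total `≤ 2` on a prefix of length `n₀` and are dominated by those of `E`
(same members) at every later position through `x`, then `weightAt 𝓝 x ≤ 2 + weightAt E x`. [folklore] -/
theorem weightAt_le_two_add_of_dominated (𝓝 E : List (X.IdealSheafData × ℕ)) (x : X) (n₀ : ℕ)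
    (hfst : 𝓝.map Prod.fst = E.map Prod.fst) (hsum : ((𝓝.map Prod.snd).take n₀).sum ≤ 2)
    (hdom : ∀ j, n₀ ≤ j → ∀ T : X.IdealSheafData, (E.map Prod.fst)[j]? = some T → x ∈ (T.support : Set X) →
      (𝓝.map Prod.snd).getD j 0 ≤ (E.map Prod.snd).getD j 0) :
    weightAt 𝓝 x ≤ 2 + weightAt E x := by
  rw [weightAt_eq_take_add_drop 𝓝 n₀ x, weightAt_eq_take_add_drop E n₀ x]
  have h1 : weightAt (𝓝.take n₀) x ≤ 2 :=
    (weightAt_le_sum_map_snd _ x).trans (by rwa [List.map_take])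
  have h2 : weightAt (𝓝.drop n₀) x ≤ weightAt (E.drop n₀) x := by
    refine weightAt_le_weightAt_of_forall _ _ x (by rw [List.map_drop, List.map_drop, hfst]) fun k T hk hx => ?_
    rw [List.map_drop, List.getElem?_drop] at hk
    have := hdom (n₀ + k) (Nat.le_add_right _ _) T (hfst ▸ hk) hx
    rwa [List.map_drop, List.map_drop, List.getD_eq_getElem?_getD, List.getD_eq_getElem?_getD, List.getElem?_drop,
      List.getElem?_drop, ← List.getD_eq_getElem?_getD, ← List.getD_eq_getElem?_getD]
  omega

end Lists

/-! ## §1 The ambient scheme of a reachable cylinder state is regular -/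

/-- [OURS · L1 W5.2] Generation 1: `X` is regular (`DepthInvariant.isRegular` inside `InitialShape`). [folklore] -/
theorem atlasInitial_isRegular : AtlasInitial (fun X _ _ => Scheme.IsRegular X) := by
  intro X _ St cyl _ _ hV hZreg hZexc hZdim h𝓔 hXexc hn hshape
  obtain ⟨S, _, _, _, _, κ₀, _, σ, _, x, _, s, P, _, _, g, i, hDI, hrange⟩ := hshape
  exact hDI.isRegular

/-- [OURS · L1 W5.2] The cylinder step keeps `X` regular: the centre `j(V(C))` is regular (`HasSNCWith.isRegular_subscheme`) and the
blowing up of a regular scheme in a regular centre is regular (Liu 8.1.19). [folklore] -/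
theorem stepStable_isRegular : StepStable (fun X _ _ => Scheme.IsRegular X) := by
  intro X X' _ _ S cyl _ _ C hC0 hCreg hCrad 𝓑 h𝓑 h𝓑C D hD hsub hBsing hperm τ hτ η hη m hm hm' hsncX cyl' τZ hτZ hsq hker htr hbd
    hbdF hV' hlow h
  exact hτ.isRegular_of_isRegular_subscheme h hsncX.isRegular_subscheme

/-- [OURS · L1 W5.2] **On every reachable cylinder state the ambient scheme is regular.** [folklore] -/
theorem CylReach.isRegular {X : Scheme.{u}} {S : MultiHostState X} {cyl : CylState S} (h : CylReach S cyl) : Scheme.IsRegular X :=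
  h _ stepStable_isRegular atlasInitial_isRegular

/-! ## §2 Generation 1 -/

/-- All exponents zero: the monomial ideal of `L.map (·, 0)` is the unit ideal. [folklore] -/
theorem monomialIdeal_map_zero {X : Scheme.{u}} (L : List X.IdealSheafData) : monomialIdeal (L.map fun T => (T, 0)) = ⊤ :=
  MultiHostState.monomialIdeal_eq_top_of_forall_snd_eq_zero _ fun p hp => by
    obtain ⟨T, _, rfl⟩ := List.mem_map.mp hp; rfl

/-- [OURS · L1 W5.2] **GENERATION 1: `NDominates` is `AtlasInitial`-valid.** Every member is the carrier (`n₀ := S.𝓔.length`, the domination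
clause is vacuous), `𝓝 := (Z, 2) :: (Z, 0) :: …`, and `monomialIdeal 𝓝 = 𝓘_Z² ≤ K` by the depth-two shape of `K` (`DepthInvariant.ker_pow_le`
for the chart `i : ℙ³ ⟶ X`, whose kernel is the carrier's: same reduced closed subscheme). [cite: Kollar2007, (3.111) Step 1] -/
theorem atlasInitial_nDominates : AtlasInitial NDominates.{u} := by
  intro X _ St cyl _ _ hV hZreg hZexc hZdim h𝓔 hXexc hn hshape
  obtain ⟨S, _, _, _, _, κ₀, _, σ, _, x, _, s, P, _, _, g, i, hDI, hrange⟩ := hshape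
  haveI := hDI.isClosedImmersion
  haveI := cyl.closedImmersion
  obtain ⟨hPint, -, -, -, hdimP⟩ := ProjectiveSpace.projSpace_standing 3 κ₀
  haveI := hPint
  -- `i.ker = cyl.j.ker`: both are the ideal of the reduced closed subscheme on `range i = range j`
  have hdimZ : topologicalKrullDim cyl.Z = ((3 : ℕ) : WithBot ℕ∞) := by rw [hZdim]; norm_cast
  have hij : Set.range i.base ⊆ Set.range cyl.j.base :=
    range_subset_of_topologicalKrullDim_eq i.isClosedEmbedding.toIsEmbedding cyl.j.isClosedEmbedding hrange 3 hdimP hdimZ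
  have hrij : Set.range i.base = Set.range cyl.j.base := Set.Subset.antisymm hij hrange
  have hker : i.ker = cyl.j.ker := by
    rw [Scheme.Hom.ker_eq_vanishingIdeal_of_isReduced i, Scheme.Hom.ker_eq_vanishingIdeal_of_isReduced cyl.j]
    congr 2
    exact congrArg closure hrij
  -- the member list is `T₀ :: rest`, all entries equal to the carrier
  obtain ⟨T₀, rest, h𝓔eq⟩ : ∃ T₀ rest, St.𝓔 = T₀ :: rest := by
    cases h : St.𝓔 with
    | nil => exact absurd (h ▸ cyl.ker_mem) (by simp)
    | cons T₀ rest => exact ⟨T₀, rest, rfl⟩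
  have hT₀ : T₀ = cyl.j.ker := h𝓔 T₀ (by rw [h𝓔eq]; exact List.mem_cons_self)
  refine ⟨St.𝓔.length, (T₀, 2) :: rest.map (fun T => (T, 0)), ?_, ?_, ?_, ?_, ?_⟩
  · -- members
    rw [h𝓔eq]
    simp [boundaryOf, Function.comp_def]
  · -- `monomialIdeal 𝓝 = Z² ≤ K`
    rw [monomialIdeal_cons, monomialIdeal_map_zero, Scheme.IdealSheafData.mul_top, hT₀, ← hker]
    exact hDI.ker_pow_le
  · -- every position is a carrier position
    intro j hj
    rw [List.getElem?_eq_getElem hj, Option.some.injEq]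
    exact h𝓔 _ (List.getElem_mem hj)
  · -- the exponents total `2`
    refine (List.Sublist.sum_le_sum (List.take_sublist _ _) fun _ _ => Nat.zero_le _).trans ?_
    have h0 : ((rest.map fun T => (T, 0)).map Prod.snd).sum = 0 :=
      List.sum_eq_zero fun a ha => by
        obtain ⟨p, hp, rfl⟩ := List.mem_map.mp ha
        obtain ⟨T, _, rfl⟩ := List.mem_map.mp hp
        rfl
    rw [List.map_cons, List.sum_cons, h0]
  · -- domination: no position past the end
    intro i' y _ j hj T hT _
    rw [List.getElem?_eq_none hj] at hT
    exact absurd hT (by simp)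

/-! ## §3 The step -/

/-- **Descent of «order ≥ 2» along a stalk isomorphism**: if `φ : A → B` is a bijective ring map of local rings and `I.map φ ≤ 𝔪_B²`, then
`I ≤ 𝔪_A²`. [folklore] -/
theorem le_maximalIdeal_sq_of_map_le {A B : Type*} [CommRing A] [CommRing B] [IsLocalRing A] [IsLocalRing B] (φ : A →+* B)
    (hφ : Function.Bijective φ) {I : Ideal A} (h : I.map φ ≤ maximalIdeal B ^ 2) : I ≤ maximalIdeal A ^ 2 := by
  have h2 : I.map φ ≤ (maximalIdeal A ^ 2).map φ := by
    rwa [Ideal.map_pow, IsLocalRing.map_maximalIdeal_of_surjective φ hφ.2]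
  have h3 := Ideal.comap_mono (f := φ) h2
  rwa [Ideal.comap_map_of_bijective φ hφ, Ideal.comap_map_of_bijective φ hφ] at h3

/-- [OURS · L1 W5.2] **THE STEP OF N-DOMINATION** (open form).  `X` regular, `S` a multi-host state with cylinder structure `cyl`, `C` an
E-side centre, `τ : X′ → X` the blowing up of `W = j(V(C))` (generic point `η`), host orders `m` with `tr i ≤ C^{m i}` and the X-side
EQUIMULTIPLICITY `ord_y (host i) = m i` at every `y ∈ W` (res-L1-w52-stub-1 (EQ)/(EQ-glue)), `S.𝓔` snc with `𝓘_W`, `cyl′` a cylinder structure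
of the successor `S′ = S.step τ W η m 0` whose carrier ideal is the strict transform of `cyl.j.ker`: then `NDominates S cyl → NDominates S′ cyl′`,
with `𝓝′ := 𝓝.map (st × id) ++ [(F, weightAt 𝓝 η)]`. [cite: Kollar2007, (3.111) Steps 1–3] [cite: CossartPiltant2008, proof of Prop. 4.2 (a)] -/
theorem nDominates_step {X X' : Scheme.{u}} [IsLocallyNoetherian X] [IsLocallyNoetherian X'] (hX : Scheme.IsRegular X)
    (S : MultiHostState X) (cyl : CylState S) (C : cyl.Z.IdealSheafData) (τ : X' ⟶ X)
    (hτ : IsBlowup τ (vanishingIdeal (cyl.centre C))) (η : X) (hη : IsGenericPoint η (cyl.centre C : Set X))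
    (m : Fin S.n → ℕ) (hm : ∀ i, cyl.tr i ≤ C ^ m i)
    (hequiX : ∀ i, ∀ y ∈ (cyl.centre C : Set X), idealOrder (S.host i) y = m i)
    (hsncX : HasSNCWith S.𝓔 (vanishingIdeal (cyl.centre C))) (cyl' : CylState (S.step τ (cyl.centre C) η m 0 hsncX hτ))
    (hker : cyl'.j.ker = strictTransformIdeal τ (vanishingIdeal (cyl.centre C)) cyl.j.ker) (h : NDominates S cyl) :
    NDominates (S.step τ (cyl.centre C) η m 0 hsncX hτ) cyl' := by
  obtain ⟨n₀, 𝓝, hbd, hle, hpfx, hsum, hdom⟩ := h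
  have hA : ∀ i, S.host i ≤ vanishingIdeal (cyl.centre C) ^ m i := fun i => MultiHostCJS.host_le_pow_centre cyl C (hm i)
  have hlen𝓝 : 𝓝.length = S.𝓔.length := by rw [← hbd, List.length_map]
  have hn₀ : n₀ ≤ S.𝓔.length := by
    by_contra hlt
    have := hpfx S.𝓔.length (not_le.mp hlt)
    rw [List.getElem?_eq_none le_rfl] at this
    exact absurd this (by simp)
  -- host order `≥ 2` at a point of `W` from `m i ≥ 2`
  have hordW : ∀ i, 2 ≤ m i → ∀ y ∈ (cyl.centre C : Set X), stalkIdeal (S.host i) y ≤ maximalIdeal (X.presheaf.stalk y) ^ 2 := by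
    intro i hmi y hy
    refine (stalkIdeal_mono (hA i) y).trans ?_
    rw [stalkIdeal_pow]
    refine (Ideal.pow_le_pow_right hmi).trans (Ideal.pow_right_mono ?_ 2)
    exact (mem_support_iff_stalkIdeal_le _ y).mp (by
      rw [← SetLike.mem_coe, Scheme.IdealSheafData.coe_support_vanishingIdeal]; exact hy)
  -- over the centre a host of order `≥ 2` upstairs has `m i ≥ 2` ((n2) + equimultiplicity)
  have hm2 : ∀ i (x' : X'), τ x' ∈ (cyl.centre C : Set X) →
      stalkIdeal ((S.step τ (cyl.centre C) η m 0 hsncX hτ).host i) x' ≤ maximalIdeal (X'.presheaf.stalk x') ^ 2 → 2 ≤ m i := by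
    intro i x' hx' hord
    have h1 : ((2 : ℕ) : ℕ∞) ≤ idealOrder ((S.step τ (cyl.centre C) η m 0 hsncX hτ).host i) x' := (le_idealOrder_iff _ x' 2).mpr hord
    have h2 := S.idealOrder_step_host_le_of_mem τ (cyl.centre C) η m 0 hsncX hτ hX hsncX.isRegular_subscheme i (hequiX i) hx'
    exact_mod_cast h1.trans h2
  -- the host order `≥ 2` descends to `τ x′` in every case
  have hdesc : ∀ i (x' : X'), stalkIdeal ((S.step τ (cyl.centre C) η m 0 hsncX hτ).host i) x' ≤ maximalIdeal (X'.presheaf.stalk x') ^ 2 →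
      stalkIdeal (S.host i) (τ x') ≤ maximalIdeal (X.presheaf.stalk (τ x')) ^ 2 := by
    intro i x' hord
    by_cases hx' : τ x' ∈ (cyl.centre C : Set X)
    · exact hordW i (hm2 i x' hx' hord) _ hx'
    · -- off the centre `τ` is a stalk isomorphism and `host′ i = τ^* host i` there
      have hnotC : τ x' ∉ ((vanishingIdeal (cyl.centre C)).support : Set X) := by
        rw [Scheme.IdealSheafData.coe_support_vanishingIdeal]; exact hx'
      have hWeq : (⟨closure {η}, isClosed_closure⟩ : Closeds X) = cyl.centre C := Closeds.ext hη
      have hτ' : IsBlowup τ (vanishingIdeal ⟨closure {η}, isClosed_closure⟩) := by rw [hWeq]; exact hτ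
      have hnot : τ x' ∉ closure {η} := by rw [show closure {η} = (cyl.centre C : Set X) from hη]; exact hx'
      haveI := hτ'.isIso_stalkMap_of_notMem_closure hnot
      have hbij : Function.Bijective (τ.stalkMap x').hom := ConcreteCategory.bijective_of_isIso _
      have hst : stalkIdeal ((S.step τ (cyl.centre C) η m 0 hsncX hτ).host i) x' =
          (stalkIdeal (S.host i) (τ x')).map (τ.stalkMap x').hom := by
        rw [MultiHostState.step_host, hτ.stalkIdeal_controlledTransform_of_not_mem _ _ hnotC, stalkIdeal_comap_eq_map_stalkMap]
      rw [hst] at hord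
      exact le_maximalIdeal_sq_of_map_le _ hbij hord
  -- the new exponent list and its bookkeeping
  have hsnd : ((𝓝.map fun p => (strictTransformIdeal τ (vanishingIdeal (cyl.centre C)) p.1, p.2)) ++
      [((vanishingIdeal (cyl.centre C)).comap τ, weightAt 𝓝 η)]).map Prod.snd = 𝓝.map Prod.snd ++ [weightAt 𝓝 η] := by
    rw [List.map_append, List.map_map]; rfl
  have hlen : (𝓝.map Prod.snd).length = S.𝓔.length := by rw [List.length_map, hlen𝓝]
  refine ⟨n₀, (𝓝.map fun p => (strictTransformIdeal τ (vanishingIdeal (cyl.centre C)) p.1, p.2)) ++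
    [((vanishingIdeal (cyl.centre C)).comap τ, weightAt 𝓝 η)], ?_, ?_, ?_, ?_, ?_⟩
  · -- members of the successor
    rw [DepthTargets.boundaryOf_map_strictTransform_append, hbd, MultiHostState.step_𝓔]
  · -- `monomialIdeal 𝓝′ = τ^*(monomialIdeal 𝓝) ≤ τ^* K ≤ K′`
    have hcomap := DepthCylinderCentre.comap_host_mul_monomialIdeal_of_isGenericPoint (τ := τ) hη
      (𝔟 := ⊤ * monomialIdeal 𝓝) (D := ⊤) (m := 0) rfl (by rw [pow_zero, Scheme.IdealSheafData.one_eq_top])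
      (by rw [hbd]; exact hsncX) hτ
    rw [controlledTransform_zero, Scheme.IdealSheafData.comap_top, Scheme.IdealSheafData.top_mul,
      Scheme.IdealSheafData.top_mul, zero_add] at hcomap
    rw [monomialIdeal_append, monomialIdeal_singleton, mul_comm, ← hcomap,
      S.K_step τ (cyl.centre C) η m 0 hsncX hτ hη hA (fun i => Nat.zero_le _)]
    exact (Scheme.IdealSheafData.comap_mono τ hle).trans (comap_le_controlledTransform τ _ _ 0)
  · -- the carrier prefix
    intro j hj
    have hj' : j < S.𝓔.length := lt_of_lt_of_le hj hn₀
    have h𝓔j := hpfx j hj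
    rw [List.getElem?_eq_getElem hj', Option.some.injEq] at h𝓔j
    rw [MultiHostState.step_𝓔, List.getElem?_append_left (by rw [List.length_map]; exact hj'), List.getElem?_map,
      List.getElem?_eq_getElem hj', Option.map_some, h𝓔j, hker]
  · -- the prefix exponents are unchanged
    rwa [hsnd, List.take_append_of_le_length (by rw [hlen]; exact hn₀)]
  · -- domination
    intro i x' hord j hj T' hT' hx'T'
    have hordx := hdesc i x' hord
    rw [MultiHostState.step_𝓔] at hT'
    rcases lt_trichotomy j S.𝓔.length with hjlt | rfl | hjgt
    · -- an old position: dominated at `τ x′`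
      rw [List.getElem?_append_left (by rw [List.length_map]; exact hjlt), List.getElem?_map,
        List.getElem?_eq_getElem hjlt, Option.map_some, Option.some.injEq] at hT'
      subst hT'
      have hτx : τ x' ∈ ((S.𝓔[j]).support : Set X) := by
        have hsub := support_antitone ((comap_le_controlledTransform τ (vanishingIdeal (cyl.centre C)) (S.𝓔[j]) 1).trans
          (controlledTransform_le_strictTransformIdeal τ (vanishingIdeal (cyl.centre C)) (S.𝓔[j]) 1))
        exact (mem_support_comap_iff τ _ x').mp (hsub hx'T')
      have h1 := hdom i (τ x') hordx j hj (S.𝓔[j]) (List.getElem?_eq_getElem hjlt) hτx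
      rwa [S.step_expAt_of_lt τ (cyl.centre C) η m 0 hsncX hτ i hjlt, hsnd, List.getD_append _ _ _ _ (by rw [hlen]; exact hjlt)]
    · -- the new member: `weightAt 𝓝 η ≤ 2 + weightAt (exps i) η ≤ m i + weightAt (exps i) η`
      rw [List.getElem?_append_right (by rw [List.length_map]), List.length_map, Nat.sub_self, List.getElem?_cons_zero,
        Option.some.injEq] at hT'
      subst hT'
      have hxW : τ x' ∈ (cyl.centre C : Set X) := by
        rw [← Scheme.IdealSheafData.coe_support_vanishingIdeal (cyl.centre C)]; exact (mem_support_comap_iff τ _ x').mp hx'T'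
      have hmi := hm2 i x' hxW hord
      have hw : weightAt 𝓝 η ≤ 2 + weightAt (S.exps i) η :=
        weightAt_le_two_add_of_dominated 𝓝 (S.exps i) η n₀
          (by rw [show 𝓝.map Prod.fst = boundaryOf 𝓝 from rfl, hbd, show (S.exps i).map Prod.fst = boundaryOf (S.exps i) from rfl,
            S.boundaryOf_exps i]) hsum
          fun j hj T hT hx => hdom i η (hordW i hmi η hη.mem) j hj T
            (by rw [show (S.exps i).map Prod.fst = boundaryOf (S.exps i) from rfl, S.boundaryOf_exps i] at hT; exact hT) hx
      rw [S.step_expAt_length τ (cyl.centre C) η m 0 hsncX hτ i, Nat.sub_zero, hsnd,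
        List.getD_append_right _ _ _ _ (by rw [hlen]), hlen, Nat.sub_self, List.getD_cons_zero]
      omega
    · -- past the end
      rw [List.getElem?_eq_none (by rw [List.length_append, List.length_map, List.length_singleton]; omega)] at hT'
      exact absurd hT' (by simp)

end Summit.ResolutionOfSingularities.ResolutionOfSingularities.Theorems.ChainW52F7BetaRP

end
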